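import Summits.NavierStokesRegularity.NavierStokesRegularity.Theorems.OddMorawetzLocal.Negative.OddMorawetzLocalJetAlgebra
import HarnessLib

/-!
# Signed permutation matrices act monomially on jet monomials

Crux `OddMorawetzLocal` (item stmt-NavierStokesRegularity-1376), refutation skeleton, stub `act_signedPerm`;
elementary list algebra over the tree's computable jet algebra
(`OddMorawetzLocal/Negative/OddMorawetzLocalJetAlgebra.lean`); Mathlib only, no named facts, no new definitions.

The substitution action `JPoly.act g` of a `3 × 3` matrix `g` expands
`∂^l v_a ↦ Σ_{b, j} g a b · Π_s g (l_s) (j_s) · ∂^{sort j} v_b` WITHOUT pruning vanishing terms.  For the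
signed permutation matrix `g = signedPermMatrix σ ε` (`g a b = ε_a` if `b = σ⁻¹ a`, `0` otherwise) every term of
the expansion of `act g [(c, m)]` is either the distinguished one (all choices `b = σ⁻¹ a`, `j_s = σ⁻¹ l_s`;
coefficient `c · sign`, monomial `(permAct σ ε m).2`) or carries the coefficient `0`.  Hence the coefficient sum
`JPoly.coeffOf` at a monomial `μ` is `c · (permAct σ ε m).1` if `μ` is the image monomial and `0` otherwise
(`act_signedPerm`).

The proof tracks, through `idxImages`, `actVar`, `prodList`/`mul`, `subst` and the final sorting of variables, the
invariant "the list `q` of (coefficient, key) pairs is concentrated at the key `x` with total `a`":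
`(∀ t ∈ q, t.2 ≠ x → t.1 = 0) ∧ (q.map fun t => if t.2 = x then t.1 else 0).sum = a` — every term whose key
differs from `x` has coefficient `0`, and the coefficients of the terms with key `x` sum to `a` (the second component,
the coefficient sum at a key, is `JPoly.coeffOf` on polynomials: `coeffOf_eq_keySum`).
-/

noncomputable section

set_option linter.dupNamespace false

namespace Summit.NavierStokesRegularity.NavierStokesRegularity.Theorems.OddMorawetz

namespace ActSignedPerm

variable {R : Type} [CommRing R] {α β : Type} [DecidableEq α]

/-! ### Coefficient sums of (coefficient, key) lists at a key -/

/-- Coefficient sum at a key: cons. -/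
theorem keySum_cons (s : R × α) (q : List (R × α)) (x : α) :
    ((s :: q).map fun t => if t.2 = x then t.1 else 0).sum =
      (if s.2 = x then s.1 else 0) + (q.map fun t => if t.2 = x then t.1 else 0).sum := by
  simp

/-- Coefficient sum at a key: concatenation. -/
theorem keySum_append (p q : List (R × α)) (x : α) :
    ((p ++ q).map fun t => if t.2 = x then t.1 else 0).sum =
      (p.map fun t => if t.2 = x then t.1 else 0).sum + (q.map fun t => if t.2 = x then t.1 else 0).sum := by
  simp [List.sum_append]

/-- Coefficient sum at a key: `flatMap`. -/
theorem keySum_flatMap {ι : Type} (l : List ι) (F : ι → List (R × α)) (x : α) :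
    ((l.flatMap F).map fun t => if t.2 = x then t.1 else 0).sum =
      (l.map fun i => ((F i).map fun t => if t.2 = x then t.1 else 0).sum).sum := by
  induction l with
  | nil => simp
  | cons i l ih => rw [List.flatMap_cons, keySum_append, ih, List.map_cons, List.sum_cons]

/-- An all-zero list has all coefficient sums zero. -/
theorem keySum_eq_zero_of_forall {q : List (R × α)} (h : ∀ t ∈ q, t.1 = 0) (x : α) :
    (q.map fun t => if t.2 = x then t.1 else 0).sum = 0 := by
  apply List.sum_eq_zero
  intro r hr
  obtain ⟨t, ht, rfl⟩ := List.mem_map.1 hr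
  split_ifs
  · exact h t ht
  · rfl

/-- The coefficient sums of a list concentrated at the key `x` with total `a`. -/
theorem keySum_eq_ite {q : List (R × α)} {a : R} {x : α}
    (h : (∀ t ∈ q, t.2 ≠ x → t.1 = 0) ∧ (q.map fun t => if t.2 = x then t.1 else 0).sum = a) (y : α) :
    (q.map fun t => if t.2 = y then t.1 else 0).sum = if y = x then a else 0 := by
  by_cases hy : y = x
  · rw [if_pos hy, hy]
    exact h.2
  · rw [if_neg hy]
    apply List.sum_eq_zero
    intro r hr
    obtain ⟨t, ht, rfl⟩ := List.mem_map.1 hr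
    split_ifs with htx
    · exact h.1 t ht fun h' => hy (htx.symm.trans h')
    · rfl

/-! ### Concentration is preserved by the list operations of the jet algebra -/

/-- A single term is concentrated at its key. -/
theorem good_singleton (a : R) (x : α) :
    (∀ t ∈ [(a, x)], t.2 ≠ x → t.1 = 0) ∧ ([(a, x)].map fun t => if t.2 = x then t.1 else 0).sum = a := by
  refine ⟨?_, ?_⟩
  · intro t ht hne
    rw [List.mem_singleton] at ht
    exact absurd (by rw [ht]) hne
  · simp

/-- Scaling the coefficients and mapping the keys preserves concentration. -/
theorem good_map [DecidableEq β] {q : List (R × α)} {a : R} {x : α}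
    (h : (∀ t ∈ q, t.2 ≠ x → t.1 = 0) ∧ (q.map fun t => if t.2 = x then t.1 else 0).sum = a)
    (c : R) (g : α → β) :
    (∀ t ∈ q.map (fun t => (c * t.1, g t.2)), t.2 ≠ g x → t.1 = 0) ∧
      ((q.map fun t => (c * t.1, g t.2)).map fun t => if t.2 = g x then t.1 else 0).sum = c * a := by
  refine ⟨?_, ?_⟩
  · intro t' ht' hne
    obtain ⟨t, ht, rfl⟩ := List.mem_map.1 ht'
    have htx : t.2 ≠ x := fun h' => hne (by simp [h'])
    show c * t.1 = 0
    rw [h.1 t ht htx, mul_zero]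
  · rw [List.map_map]
    have hc : q.map ((fun t : R × β => if t.2 = g x then t.1 else 0) ∘ fun t => (c * t.1, g t.2)) =
        q.map fun t => c * (if t.2 = x then t.1 else 0) := by
      apply List.map_congr_left
      intro t ht
      simp only [Function.comp_apply]
      by_cases htx : t.2 = x
      · rw [if_pos (by rw [htx]), if_pos htx]
      · rw [if_neg htx, mul_zero]
        split_ifs
        · rw [h.1 t ht htx, mul_zero]
        · rfl
    rw [hc, List.sum_map_mul_left]
    congr 1
    exact h.2

/-- Mapping the keys preserves concentration. -/
theorem good_mapKey [DecidableEq β] {q : List (R × α)} {a : R} {x : α}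
    (h : (∀ t ∈ q, t.2 ≠ x → t.1 = 0) ∧ (q.map fun t => if t.2 = x then t.1 else 0).sum = a) (g : α → β) :
    (∀ t ∈ q.map (fun t => (t.1, g t.2)), t.2 ≠ g x → t.1 = 0) ∧
      ((q.map fun t => (t.1, g t.2)).map fun t => if t.2 = g x then t.1 else 0).sum = a := by
  have := good_map h 1 g
  simp only [one_mul] at this
  exact this

omit [DecidableEq α] in
/-- A zero scaling factor produces an all-zero list. -/
theorem forall_map_of_eq_zero (q : List (R × α)) {c : R} (hc : c = 0) (g : α → β) :
    ∀ t ∈ q.map (fun t => (c * t.1, g t.2)), t.1 = 0 := by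
  intro t' ht'
  obtain ⟨t, _, rfl⟩ := List.mem_map.1 ht'
  show c * t.1 = 0
  rw [hc, zero_mul]

/-- Appending an all-zero list on the right preserves concentration. -/
theorem good_append_zero {p q : List (R × α)} {a : R} {x : α}
    (hp : (∀ t ∈ p, t.2 ≠ x → t.1 = 0) ∧ (p.map fun t => if t.2 = x then t.1 else 0).sum = a)
    (hq : ∀ t ∈ q, t.1 = 0) :
    (∀ t ∈ p ++ q, t.2 ≠ x → t.1 = 0) ∧ ((p ++ q).map fun t => if t.2 = x then t.1 else 0).sum = a := by
  refine ⟨?_, ?_⟩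
  · intro t ht hne
    rcases List.mem_append.1 ht with h | h
    · exact hp.1 t h hne
    · exact hq t h
  · rw [keySum_append, keySum_eq_zero_of_forall hq, add_zero]
    exact hp.2

/-- Appending an all-zero list on the left preserves concentration. -/
theorem zero_append_good {p q : List (R × α)} {a : R} {x : α} (hp : ∀ t ∈ p, t.1 = 0)
    (hq : (∀ t ∈ q, t.2 ≠ x → t.1 = 0) ∧ (q.map fun t => if t.2 = x then t.1 else 0).sum = a) :
    (∀ t ∈ p ++ q, t.2 ≠ x → t.1 = 0) ∧ ((p ++ q).map fun t => if t.2 = x then t.1 else 0).sum = a := by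
  refine ⟨?_, ?_⟩
  · intro t ht hne
    rcases List.mem_append.1 ht with h | h
    · exact hp t h
    · exact hq.1 t h hne
  · rw [keySum_append, keySum_eq_zero_of_forall hp, zero_add]
    exact hq.2

/-- A `flatMap` over a duplicate-free index list, all of whose pieces but one are all-zero, is concentrated where
the remaining piece is. -/
theorem good_flatMap {ι : Type} {l : List ι} (hl : l.Nodup) {j₀ : ι} (hj₀ : j₀ ∈ l)
    (Q : ι → List (R × α)) {a : R} {x : α}
    (hQ : (∀ t ∈ Q j₀, t.2 ≠ x → t.1 = 0) ∧ ((Q j₀).map fun t => if t.2 = x then t.1 else 0).sum = a)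
    (hZ : ∀ j ∈ l, j ≠ j₀ → ∀ t ∈ Q j, t.1 = 0) :
    (∀ t ∈ l.flatMap Q, t.2 ≠ x → t.1 = 0) ∧
      ((l.flatMap Q).map fun t => if t.2 = x then t.1 else 0).sum = a := by
  induction l with
  | nil => simp at hj₀
  | cons j l ih =>
    rw [List.flatMap_cons]
    rw [List.nodup_cons] at hl
    by_cases hj : j = j₀
    · subst hj
      have hZ' : ∀ t ∈ l.flatMap Q, t.1 = 0 := by
        intro t ht
        obtain ⟨i, hi, hti⟩ := List.mem_flatMap.1 ht
        exact hZ i (List.mem_cons_of_mem _ hi) (fun h => hl.1 (h ▸ hi)) t hti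
      exact good_append_zero hQ hZ'
    · have hj₀' : j₀ ∈ l := (List.mem_cons.1 hj₀).resolve_left (Ne.symm hj)
      exact zero_append_good (hZ j List.mem_cons_self hj)
        (ih hl.2 hj₀' fun i hi hne => hZ i (List.mem_cons_of_mem _ hi) hne)

end ActSignedPerm

namespace ActSignedPerm

variable {R : Type} [CommRing R]

/-! ### Concentration through the jet algebra of a signed permutation matrix -/

/-- Products of concentrated polynomials are concentrated (keys concatenate, coefficients multiply). -/
theorem good_mul {p q : JPoly R} {a b : R} {x y : List JVar}
    (hp : (∀ t ∈ p, t.2 ≠ x → t.1 = 0) ∧ (p.map fun t => if t.2 = x then t.1 else 0).sum = a)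
    (hq : (∀ t ∈ q, t.2 ≠ y → t.1 = 0) ∧ (q.map fun t => if t.2 = y then t.1 else 0).sum = b) :
    (∀ t ∈ JPoly.mul p q, t.2 ≠ x ++ y → t.1 = 0) ∧
      ((JPoly.mul p q).map fun t => if t.2 = x ++ y then t.1 else 0).sum = a * b := by
  unfold JPoly.mul
  refine ⟨?_, ?_⟩
  · intro u hu hne
    obtain ⟨s, hs, hu⟩ := List.mem_flatMap.1 hu
    obtain ⟨t, ht, rfl⟩ := List.mem_map.1 hu
    show s.1 * t.1 = 0
    by_cases hsx : s.2 = x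
    · have hty : t.2 ≠ y := fun h => hne (by simp [hsx, h])
      rw [hq.1 t ht hty, mul_zero]
    · rw [hp.1 s hs hsx, zero_mul]
  · rw [keySum_flatMap]
    have hc : (p.map fun s => ((q.map fun t => (s.1 * t.1, s.2 ++ t.2)).map
          fun t => if t.2 = x ++ y then t.1 else 0).sum) = p.map fun s => (if s.2 = x then s.1 else 0) * b := by
      apply List.map_congr_left
      intro s _
      rw [keySum_eq_ite (good_map hq s.1 (fun k => s.2 ++ k)) (x ++ y)]
      by_cases hsx : s.2 = x
      · rw [if_pos (by rw [hsx]), if_pos hsx]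
      · rw [if_neg (fun h => hsx (List.append_cancel_right h).symm), if_neg hsx, zero_mul]
    rw [hc, List.sum_map_mul_right]
    congr 1
    exact hp.2

/-- The product of a list of polynomials, each concentrated at a single variable, is concentrated at the monomial
formed by these variables. -/
theorem good_prodList (F : JVar → JPoly R) (A : JVar → R) (X : JVar → JVar) (m : List JVar)
    (h : ∀ v ∈ m,
      (∀ t ∈ F v, t.2 ≠ [X v] → t.1 = 0) ∧ ((F v).map fun t => if t.2 = [X v] then t.1 else 0).sum = A v) :
    (∀ t ∈ JPoly.prodList (m.map F), t.2 ≠ m.map X → t.1 = 0) ∧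
      ((JPoly.prodList (m.map F)).map fun t => if t.2 = m.map X then t.1 else 0).sum = (m.map A).prod := by
  induction m with
  | nil => simp [JPoly.prodList]
  | cons v m ih =>
    have hh := good_mul (h v List.mem_cons_self) (ih fun w hw => h w (List.mem_cons_of_mem _ hw))
    rw [List.singleton_append] at hh
    rw [List.map_cons, List.map_cons, List.map_cons, List.prod_cons]
    exact hh

/-- Entries of the signed permutation matrix. -/
theorem signedPermMatrix_apply (σ : Equiv.Perm (Fin 3)) (ε : Fin 3 → Bool) (i j : Fin 3) :
    (signedPermMatrix σ ε : Matrix (Fin 3) (Fin 3) R) i j =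
      if j = σ.symm i then (if ε i then 1 else -1) else 0 := rfl

/-- Off the permutation pattern the entries vanish. -/
theorem signedPermMatrix_apply_of_ne (σ : Equiv.Perm (Fin 3)) (ε : Fin 3 → Bool) {i j : Fin 3}
    (h : j ≠ σ.symm i) : (signedPermMatrix σ ε : Matrix (Fin 3) (Fin 3) R) i j = 0 := by
  rw [signedPermMatrix_apply, if_neg h]

/-- On the permutation pattern the entries are the signs. -/
theorem signedPermMatrix_apply_symm (σ : Equiv.Perm (Fin 3)) (ε : Fin 3 → Bool) (i : Fin 3) :
    (signedPermMatrix σ ε : Matrix (Fin 3) (Fin 3) R) i (σ.symm i) = ((sgn (ε i) : ℤ) : R) := by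
  rw [signedPermMatrix_apply, if_pos rfl]
  cases ε i <;> simp [sgn]

/-- The index images of a signed permutation matrix are concentrated at the permuted index list, with total
coefficient the product of the signs. -/
theorem good_idxImages (σ : Equiv.Perm (Fin 3)) (ε : Fin 3 → Bool) (l : List (Fin 3)) :
    (∀ t ∈ JPoly.idxImages (signedPermMatrix σ ε : Matrix (Fin 3) (Fin 3) R) l,
        t.2 ≠ l.map σ.symm → t.1 = 0) ∧
      ((JPoly.idxImages (signedPermMatrix σ ε : Matrix (Fin 3) (Fin 3) R) l).map
          fun t => if t.2 = l.map σ.symm then t.1 else 0).sum = (l.map fun i => ((sgn (ε i) : ℤ) : R)).prod := by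
  induction l with
  | nil => simp [JPoly.idxImages]
  | cons i is ih =>
    rw [JPoly.idxImages, List.map_cons, List.map_cons, List.prod_cons]
    refine good_flatMap (List.nodup_finRange 3) (List.mem_finRange (σ.symm i)) _ ?_ ?_
    · rw [← signedPermMatrix_apply_symm (R := R) σ ε i]
      exact good_map ih ((signedPermMatrix σ ε : Matrix (Fin 3) (Fin 3) R) i (σ.symm i)) (fun k => σ.symm i :: k)
    · intro j _ hj
      exact forall_map_of_eq_zero _ (signedPermMatrix_apply_of_ne (R := R) σ ε hj) (fun k => j :: k)

/-- The image of a variable under a signed permutation matrix is concentrated at the permuted variable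
`(permActVar σ ε v).2`, with total coefficient the sign `(permActVar σ ε v).1` (kept as a product of casts). -/
theorem good_actVar (σ : Equiv.Perm (Fin 3)) (ε : Fin 3 → Bool) (v : JVar) :
    (∀ t ∈ JPoly.actVar (signedPermMatrix σ ε : Matrix (Fin 3) (Fin 3) R) v, t.2 ≠ [(permActVar σ ε v).2] →
        t.1 = 0) ∧
      ((JPoly.actVar (signedPermMatrix σ ε : Matrix (Fin 3) (Fin 3) R) v).map
          fun t => if t.2 = [(permActVar σ ε v).2] then t.1 else 0).sum =
        ((sgn (ε v.1) : ℤ) : R) * (v.2.map fun i => ((sgn (ε i) : ℤ) : R)).prod := by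
  unfold JPoly.actVar
  refine good_flatMap (List.nodup_finRange 3) (List.mem_finRange (σ.symm v.1)) _ ?_ ?_
  · rw [← signedPermMatrix_apply_symm (R := R) σ ε v.1]
    exact good_map (good_idxImages σ ε v.2)
      ((signedPermMatrix σ ε : Matrix (Fin 3) (Fin 3) R) v.1 (σ.symm v.1)) (fun k => [(σ.symm v.1, sortIdx k)])
  · intro b _ hb
    exact forall_map_of_eq_zero _ (signedPermMatrix_apply_of_ne (R := R) σ ε hb) (fun k => [(b, sortIdx k)])

/-- The unpruned action of a signed permutation matrix on a one-term polynomial `c · m` is concentrated at the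
image monomial `(permAct σ ε m).2` with total coefficient `c · (permAct σ ε m).1`. -/
theorem good_act (σ : Equiv.Perm (Fin 3)) (ε : Fin 3 → Bool) (c : R) (m : List JVar) :
    (∀ t ∈ JPoly.act (signedPermMatrix σ ε : Matrix (Fin 3) (Fin 3) R) [(c, m)], t.2 ≠ (permAct σ ε m).2 →
        t.1 = 0) ∧
      ((JPoly.act (signedPermMatrix σ ε : Matrix (Fin 3) (Fin 3) R) [(c, m)]).map
          fun t => if t.2 = (permAct σ ε m).2 then t.1 else 0).sum = c * ((permAct σ ε m).1 : R) := by
  have h1 := good_prodList (JPoly.actVar (signedPermMatrix σ ε : Matrix (Fin 3) (Fin 3) R))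
    (fun v => ((sgn (ε v.1) : ℤ) : R) * (v.2.map fun i => ((sgn (ε i) : ℤ) : R)).prod)
    (fun v => (permActVar σ ε v).2) m (fun v _ => good_actVar σ ε v)
  have h2 := good_mapKey (good_map h1 c id) sortVars
  have hcast : (m.map fun v => ((sgn (ε v.1) : ℤ) : R) * (v.2.map fun i => ((sgn (ε i) : ℤ) : R)).prod).prod =
      ((permAct σ ε m).1 : R) := by
    simp [permAct, permActVar, Int.cast_list_prod, List.map_map, Function.comp_def]
  have hact : JPoly.act (signedPermMatrix σ ε : Matrix (Fin 3) (Fin 3) R) [(c, m)] =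
      (((JPoly.prodList (m.map (JPoly.actVar (signedPermMatrix σ ε : Matrix (Fin 3) (Fin 3) R)))).map
        fun t => (c * t.1, id t.2)).map fun t => (t.1, sortVars t.2)) := by
    simp [JPoly.act, JPoly.subst]
  rw [hact, ← hcast]
  exact h2

/-- The coefficient sum `JPoly.coeffOf p μ` is the coefficient sum of `p` at the key `μ`. -/
theorem coeffOf_eq_keySum (p : JPoly R) (μ : List JVar) :
    JPoly.coeffOf p μ = (p.map fun t => if t.2 = μ then t.1 else 0).sum := by
  induction p with
  | nil => simp [JPoly.coeffOf]
  | cons t p ih =>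
    unfold JPoly.coeffOf at ih ⊢
    rw [keySum_cons, ← ih, List.filter_cons]
    by_cases h : t.2 = μ
    · simp [h]
    · simp [h]

end ActSignedPerm

open ActSignedPerm in
/-- **Signed permutation matrices act monomially** (stub `act_signedPerm` of crux `OddMorawetzLocal`).  For the
signed coordinate permutation `(σ, ε) ∈ B₃`, the unpruned substitution action of its matrix on the one-term
polynomial `c · m` has coefficient sum `c · (permAct σ ε m).1` (`= ± c`) at the image monomial
`(permAct σ ε m).2` and `0` at every other monomial: all terms of the expansion except the distinguished one carry
a vanishing matrix entry. -/
theorem act_signedPerm {R : Type} [CommRing R] (σ : Equiv.Perm (Fin 3)) (ε : Fin 3 → Bool) (c : R)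
    (m : List JVar) (μ : List JVar) :
    JPoly.coeffOf (JPoly.act (signedPermMatrix σ ε) [(c, m)]) μ =
      if μ = (permAct σ ε m).2 then c * ((permAct σ ε m).1 : R) else 0 := by
  rw [coeffOf_eq_keySum]
  exact keySum_eq_ite (good_act σ ε c m) μ

end Summit.NavierStokesRegularity.NavierStokesRegularity.Theorems.OddMorawetz

end
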